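import Summits.QuantumAdvantage.QuantumAdvantage.Theorems.LinnikCubicClassGroupsPureCubicClassGroupFBQPStubClassTableSemWalkPkg
import Summits.QuantumAdvantage.QuantumAdvantage.Theorems.LinnikCubicClassGroupsPureCubicClassGroupFBQPStubSemCellB
import Summits.QuantumAdvantage.QuantumAdvantage.Theorems.LinnikCubicClassGroupsPureCubicClassGroupFBQPStubClassTableSemNumerics2
import Summits.QuantumAdvantage.QuantumAdvantage.Theorems.LinnikCubicClassGroupsPureCubicClassGroupFBQPStubSemSetup
import Summits.QuantumAdvantage.QuantumAdvantage.Theorems.LinnikCubicClassGroupsPureCubicClassGroupFBQPStubSemCoords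
import Summits.QuantumAdvantage.QuantumAdvantage.Theorems.LinnikCubicClassGroupsPureCubicClassGroupFBQPStubSemDrift

/-!
# Crux `LinnikCubicClassGroups.PureCubicClassGroupFBQP` (stmt-QuantumAdvantage-11544) — stub `stub_semMain`, part CORE (variant B, Circle-free imports)

Line `arakelov-giant-step-cycle`, stub `stub_semMain` (S5b-P5b-M): **one table value is the shift-cell value**. For a position
`v = E + W j` of the ladder class table (true cube roots), with the class data of the block `E` (`A_E = α_E · A_g`), the circle
of the class (`G`, `n₀`, `idx`, `Lab`), the shift `y_E` (`y_E R/2^s ≡ −log σ₁ α_E + ((R̂−R)/R̂)·Σ_t e_t log σ₁ γ_t (mod R)`) and its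
floor `σ_E`, and `j` off the defect windows, the table value is the cell of the grid point `(σ_E + j) mod 2^s`:

`walk_package` (the walk stops at `β⁻¹ A_E`, `β = α_E θ(k₀)`, just left of `t⋆ = t̂ + N·Rint`) + the drift lemma (`t⋆/2^prec =
j'Δ + N R + ((R̂−R)/R̂)·main + O(2^-k)`, `stub_semDrift`, imported) + the shift congruence put `u = t⋆/2^prec − log σ₁(α_E ε^Q)` within
`(−ηd, Δ + ηd)` of the window of grid point `σ_E + j` (`ηd = R/2^(s+3)` by `num_BN`, `num_etaerr_halved`); `semTable_value_eq_cellB` (tolerance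
`η = R/2^(s+3)` by `num_eta`) and the coordinate lemma (`stub_semCoords`, imported) finish. [Hallgren 2005 §4; Buchmann–Williams 1988 §3]
-/

set_option linter.dupNamespace false

namespace Summit.QuantumAdvantage.QuantumAdvantage.Theorems.LinnikCubicClassGroups

open scoped NumberField nonZeroDivisors
open NumberField
open Literature.NumberTheory.CubicFields
open Literature.NumberTheory.CubicFields.PureCubicCodes (Canon Mem)
open Literature.NumberTheory.NumberFields.PureCubic (abs_discr_le ne_zero_of_squarefree_mul)
open Literature.Computability.Cryptography
open Literature.Computability.Cryptography.CubicClassTable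
open Literature.Computability.Cryptography.CubicClassTable.WalkFns

section Core

variable {K : Type} [Field K] [NumberField K] {θ : K} {σ₁ : K →+* ℝ} {σ₂ : K →+* ℂ} {F : WalkFns} {I : Inst}
variable (hdeg : Module.finrank ℚ K = 3) (hσ₂ : ∃ z : K, starRingEnd ℂ (σ₂ z) ≠ σ₂ z)
  (ε : (𝓞 K)ˣ) (hε : 1 < σ₁ (algebraMap (𝓞 K) K ε)) (hreg : Real.log (σ₁ (algebraMap (𝓞 K) K ε)) = Units.regulator K)
  (hab : Squarefree (I.a * I.b)) (hab1 : I.a * I.b ≠ 1) (hθ : θ ^ 3 = ((I.a * I.b ^ 2 : ℕ) : K))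
  (hred : RedSem F I.a I.b K θ σ₁ σ₂) (hprod : ProdSpec I.a I.b K θ F.latProd)
  {cap : ℕ} (hcap : (243 * I.a ^ 2 * I.b ^ 2) ^ 2 ≤ cap)
  (hord : Canon I.ord) (hordm : ∀ φ : K, Mem θ I.b I.ord φ ↔ IsIntegral ℤ φ)
  (h6 : ∀ A : FractionalIdeal (𝓞 K)⁰ K, A ≠ 0 → ∀ x₀ ∈ posRelMinima σ₁ σ₂ A, ∀ i : ℤ,
    2 * σ₁ (voronoiChain σ₁ σ₂ A x₀ i) ≤ σ₁ (voronoiChain σ₁ σ₂ A x₀ (i + 6)))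
  (hR6 : Real.log 2 / 6 ≤ Units.regulator K)
  (hs₀ : I.s₀ = 18 * (10 * Nat.size (I.a * I.b) + 48)) (hTdbl : 6 * Nat.size (27 * I.a ^ 2 * I.b ^ 2) + 16 ≤ I.Tdbl)
  (hBb : 32 * (10 * Nat.size (I.a * I.b) + 48) ^ 2 ≤ I.Bb) (hmargin : I.margin = 0)
  (hr : |(I.r : ℝ) - 2 ^ I.k * Units.regulator K| ≤ 1)
  {e sz : ℕ} (hsz : I.ps.length < 2 ^ sz)
  (hk : I.ℓe + I.s + I.npp + 60 + 6 * Nat.size (27 * I.a ^ 2 * I.b ^ 2) + e + 2 * sz ≤ I.k)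
  (hkprec : I.k + I.s + I.npp + 64 ≤ I.prec) (hs : I.npp + 6 * Nat.size (27 * I.a ^ 2 * I.b ^ 2) + 50 + e ≤ I.s)
  {𝔤 : ℕ → Ideal (𝓞 K)} {γ : ℕ → K}
  (hslot : ∀ v, ∀ t < I.T, 𝔤 t ≠ ⊥ ∧ Canon (F.gT I v t) ∧
    (∀ φ : K, Mem θ I.b (F.gT I v t) φ ↔ φ ∈ (𝔤 t : FractionalIdeal (𝓞 K)⁰ K)) ∧
    γ t ∈ (𝔤 t : FractionalIdeal (𝓞 K)⁰ K) ∧ 0 < σ₁ (γ t) ∧ ‖σ₂ (γ t)‖ < 1 ∧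
    (∀ φ : K, φ ∈ (𝔤 t : FractionalIdeal (𝓞 K)⁰ K) → 0 < σ₁ φ → ‖σ₂ φ‖ < 1 → σ₁ (γ t) ≤ σ₁ φ))

include hdeg hσ₂ hε hreg hab hab1 hθ hred hprod hcap hord hordm h6 hR6 hs₀ hTdbl hBb hmargin hr hsz hk hkprec hs hslot in
set_option maxHeartbeats 800000 in
/-- **One table value is the shift-cell value** (see the module docstring; the composition is long, hence the
heartbeat budget). -/
theorem table_value_eq_shiftCell {E j : ℕ} (hE : E < I.W) (hj : j < 2 ^ I.ℓy)
    {Ag : FractionalIdeal (𝓞 K)⁰ K} {αE : K} (hαE : 0 < σ₁ αE)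
    (hAE : ∏ t ∈ Finset.range I.T, ((𝔤 t : Ideal (𝓞 K)) : FractionalIdeal (𝓞 K)⁰ K) ^ (E / (2 ^ I.ℓe) ^ t % 2 ^ I.ℓe) =
      FractionalIdeal.spanSingleton (𝓞 K)⁰ αE * Ag)
    {x₀ : K} (hx₀ : x₀ ∈ posRelMinima σ₁ σ₂ Ag) {n₀ : ℕ} (hn₀ : 0 < n₀)
    (hper : ∀ i, Real.log (σ₁ (voronoiChain σ₁ σ₂ Ag x₀ (i + n₀))) =
      Real.log (σ₁ (voronoiChain σ₁ σ₂ Ag x₀ i)) + Units.regulator K)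
    {idx : ℝ → ℤ} (hidx : ∀ x, Real.log (σ₁ (voronoiChain σ₁ σ₂ Ag x₀ (idx x))) ≤ x ∧
      x < Real.log (σ₁ (voronoiChain σ₁ σ₂ Ag x₀ (idx x + 1))))
    {Lab : ℤ → ℕ × List ℤ} (hLab : ∀ i, Canon (Lab i) ∧ ∀ φ : K, Mem θ I.b (Lab i) φ ↔
      φ ∈ FractionalIdeal.spanSingleton (𝓞 K)⁰ (voronoiChain σ₁ σ₂ Ag x₀ i)⁻¹ * Ag)
    (hLabper : ∀ i j, Lab i = Lab j ↔ (n₀ : ℤ) ∣ i - j)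
    {yE : ℝ} {σE : ℕ} (hσE : (σE : ℝ) ≤ yE ∧ yE < σE + 1)
    (hyE : ∃ q : ℤ, yE * (Units.regulator K / ((2 ^ I.s : ℕ) : ℝ)) =
      (-Real.log (σ₁ αE) + ((I.r : ℝ) / 2 ^ I.k - Units.regulator K) / ((I.r : ℝ) / 2 ^ I.k) *
        ∑ t ∈ Finset.range I.T, ((E / (2 ^ I.ℓe) ^ t % 2 ^ I.ℓe : ℕ) : ℝ) * Real.log (σ₁ (γ t))) +
        q * Units.regulator K)
    (hgood : ∀ (k : ℤ) (m : ℕ), (m : ℝ) / (2 : ℝ) ^ I.npp <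
        Real.log (σ₁ (voronoiChain σ₁ σ₂ Ag x₀ (k + 1))) - Real.log (σ₁ (voronoiChain σ₁ σ₂ Ag x₀ k)) →
      ¬ ((σE : ℝ) * (Units.regulator K / ((2 ^ I.s : ℕ) : ℝ)) + (j : ℝ) * (Units.regulator K / ((2 ^ I.s : ℕ) : ℝ)) -
            (Units.regulator K / 2 ^ (I.s + 3) + Units.regulator K / 2 ^ (I.s + 3)) ≤
            Real.log (σ₁ (voronoiChain σ₁ σ₂ Ag x₀ k)) + m / (2 : ℝ) ^ I.npp ∧
          Real.log (σ₁ (voronoiChain σ₁ σ₂ Ag x₀ k)) + m / (2 : ℝ) ^ I.npp ≤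
            (σE : ℝ) * (Units.regulator K / ((2 ^ I.s : ℕ) : ℝ)) + (j : ℝ) * (Units.regulator K / ((2 ^ I.s : ℕ) : ℝ)) +
              Units.regulator K / ((2 ^ I.s : ℕ) : ℝ) +
              (Units.regulator K / 2 ^ (I.s + 3) + Units.regulator K / 2 ^ (I.s + 3)))) :
    F.classTableOpQ I cap (E + I.W * j) =
      (Lab (idx ((((σE + j) % 2 ^ I.s : ℕ) : ℝ) * (Units.regulator K / ((2 ^ I.s : ℕ) : ℝ)))),
        ⌊(((((σE + j) % 2 ^ I.s : ℕ) : ℝ) * (Units.regulator K / ((2 ^ I.s : ℕ) : ℝ))) -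
          Real.log (σ₁ (voronoiChain σ₁ σ₂ Ag x₀
            (idx ((((σE + j) % 2 ^ I.s : ℕ) : ℝ) * (Units.regulator K / ((2 ^ I.s : ℕ) : ℝ))))))) *
          (2 : ℝ) ^ I.npp⌋₊) := by
  classical
  -- ### basic numerics of the instance
  obtain ⟨ha, hb⟩ := ne_zero_of_squarefree_mul hab
  obtain ⟨hprec, h9, hk4, hks, hnpp⟩ := inst_numerics (npp := I.npp) ha hb hk hkprec
  have hLD' : Nat.size (I.a * I.b) ≤ Nat.size (27 * I.a ^ 2 * I.b ^ 2) := size_ab_le ha hb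
  have hR16 : (1 : ℝ) / 16 ≤ Units.regulator K := regulator_sixteenth_le hR6
  have hRpos : 0 < Units.regulator K := lt_of_lt_of_le (by norm_num) hR16
  obtain ⟨hLBKN, -, -, hd0⟩ := walk_consts (I := I) hdeg hab hab1 hθ hprec
  obtain ⟨hLB0, -⟩ := logB_bounds (K := K)
  obtain ⟨hr0, hRint0, -⟩ := walk_Rint (I := I) hR6 hr hk4 hks
  have hd1 : (1 : ℝ) ≤ |(discr K : ℝ)| := by
    rw [← Int.cast_abs]; exact_mod_cast Int.one_le_abs (discr_ne_zero K)
  -- ### the layout of the position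
  obtain ⟨-, -, hdig, htgt⟩ := inst_pos_decomp I hE hj
  -- ### the walk
  obtain ⟨β, N, n, hβ, hcn, hmn, hnmax, hpos, hρ, hlt, hl, hN, hNb⟩ :=
    walk_package hdeg hσ₂ ε hε hab hab1 hθ hred hprod hcap hprec hord hordm h6 hR6 hs₀ hTdbl hBb hmargin hr hk4 hks
      (E + I.W * j) 𝔤 γ (hslot (E + I.W * j))
  -- abbreviations (after the walk, so that its conclusions are abstracted too)
  set v : ℕ := E + I.W * j with hv
  set R : ℝ := Units.regulator K with hRdef
  set S2 : ℝ := ((2 ^ I.s : ℕ) : ℝ) with hS2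
  set LD : ℕ := Nat.size (27 * I.a ^ 2 * I.b ^ 2) with hLD
  set LB : ℝ := Real.log (3 * Real.sqrt |(discr K : ℝ)|) with hLB
  set Sd : ℝ := ∑ t ∈ Finset.range I.T, (I.digit v t : ℝ) with hSd
  set main : ℝ := ∑ t ∈ Finset.range I.T, (I.digit v t : ℝ) * Real.log (σ₁ (γ t)) with hmain
  set cδ : ℝ := ((I.r : ℝ) / 2 ^ I.k - R) / ((I.r : ℝ) / 2 ^ I.k) with hcδ
  set ηd : ℝ := R / 2 ^ (I.s + 3) with hηd
  have hS2pos : 0 < S2 := by rw [hS2]; positivity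
  have hS2e : S2 = (2 : ℝ) ^ I.s := by rw [hS2]; push_cast; ring
  have hΔpos : 0 < R / S2 := div_pos hRpos hS2pos
  have hRS2 : S2 * (R / S2) = R := mul_div_cancel₀ _ hS2pos.ne'
  have hηdpos : 0 < ηd := by rw [hηd]; positivity
  -- the ideal of the block in class form
  have hprodE : ∏ t ∈ Finset.range I.T, ((𝔤 t : Ideal (𝓞 K)) : FractionalIdeal (𝓞 K)⁰ K) ^ I.digit v t =
      FractionalIdeal.spanSingleton (𝓞 K)⁰ αE * Ag := by
    rw [← hAE]; exact Finset.prod_congr rfl fun t _ => by rw [hdig t]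
  rw [hprodE] at hβ hmn hl
  have hmainE : main = ∑ t ∈ Finset.range I.T, ((E / (2 ^ I.ℓe) ^ t % 2 ^ I.ℓe : ℕ) : ℝ) * Real.log (σ₁ (γ t)) := by
    rw [hmain]; exact Finset.sum_congr rfl fun t _ => by rw [hdig t]
  have hSd0 : 0 ≤ Sd := by rw [hSd]; exact Finset.sum_nonneg fun t _ => by positivity
  have hSdle : Sd ≤ ((3 * I.ps.length : ℕ) : ℝ) * 2 ^ I.ℓe := by
    have hdlt : ∀ t ∈ Finset.range I.T, (I.digit v t : ℝ) ≤ 2 ^ I.ℓe := by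
      intro t _
      have : I.digit v t < 2 ^ I.ℓe := by unfold Inst.digit Inst.M; exact Nat.mod_lt _ (by positivity)
      exact_mod_cast this.le
    calc Sd ≤ ∑ _t ∈ Finset.range I.T, (2 : ℝ) ^ I.ℓe := Finset.sum_le_sum hdlt
      _ = ((3 * I.ps.length : ℕ) : ℝ) * 2 ^ I.ℓe := by
          rw [Finset.sum_const, Finset.card_range, nsmul_eq_mul]; rfl
  -- ### the drift of the target: `t⋆/2^prec = j'Δ + N R + cδ·main + err`, `|err| ≤ ηd`
  set BN : ℝ := 2 + (3 * Sd + 2 ^ I.prec * (2 * LB) * Sd) / I.Rint with hBN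
  have hN' : F.tstarc I cap v = ((j % 2 ^ I.s * I.r * 2 ^ (I.prec - I.k - I.s) : ℕ) : ℤ) +
      N * ((I.r * 2 ^ (I.prec - I.k) : ℕ) : ℤ) := by rw [← htgt]; exact hN
  have hjmod : j % 2 ^ I.s < 2 ^ I.s := Nat.mod_lt _ (by positivity)
  have hdrift := stub_semDrift I.prec I.k I.s I.r R main BN (j % 2 ^ I.s) N (F.tstarc I cap v) hr0 hks hjmod hr hN' hNb
  rw [← hS2] at hdrift
  have hLB3 : 3 / 2 ^ I.prec ≤ LB := three_div_le_logB hd1 h9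
  have hRintge : (2 : ℝ) ^ I.prec / 16 ≤ (I.Rint : ℝ) := Rint_ge hr hR6 (by omega) (by omega)
  have hBNle : BN ≤ 2 + 48 * (((3 * I.ps.length : ℕ) : ℝ) * 2 ^ I.ℓe) * LB := num_BN hSd0 hSdle hLB3 hRintge
  have hLB2 : LB ≤ 2 ^ (LD + 6) :=
    (by linarith : LB ≤ ((10 * Nat.size (I.a * I.b) + 48 : ℕ) : ℝ)).trans (num_KN_le hLD')
  have hetaerr := num_etaerr_halved (ℓe := I.ℓe) (s := I.s) (npp := I.npp) (LD := LD) (e := e) (sz := sz) (k := I.k)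
    (np := I.ps.length) hR16 hsz hLB0 hLB2 hk
  have herr : (BN + 1) / 2 ^ I.k ≤ ηd / 2 := by
    rw [hηd]
    have h2 : (BN + 1) / 2 ^ I.k ≤ 1 / 2 ^ I.k * (1 + (2 + 48 * (((3 * I.ps.length : ℕ) : ℝ) * 2 ^ I.ℓe) * LB)) := by
      rw [one_div, inv_mul_eq_div]
      apply div_le_div_of_nonneg_right _ (by positivity)
      linarith
    have h3 : R / 2 ^ (I.s + 4) = R / 2 ^ (I.s + 3) / 2 := by rw [pow_succ]; ring
    rw [← h3]
    exact h2.trans hetaerr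
  set err : ℝ := (F.tstarc I cap v : ℝ) / 2 ^ I.prec -
    (((j % 2 ^ I.s : ℕ) : ℝ) * (R / S2) + (N : ℝ) * R + cδ * main) with herrdef
  have herrb : |err| ≤ ηd / 2 := hdrift.trans herr
  -- ### the shift congruence and the lap count
  obtain ⟨qE, hqE⟩ := hyE
  rw [← hmainE] at hqE
  try rw [← hS2] at hqE
  -- `j = 2^s (j / 2^s) + j % 2^s`
  have hjdec : (j : ℝ) * (R / S2) = ((j / 2 ^ I.s : ℕ) : ℝ) * R + ((j % 2 ^ I.s : ℕ) : ℝ) * (R / S2) := by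
    have h := Nat.div_add_mod j (2 ^ I.s)
    have h' : (j : ℝ) = S2 * ((j / 2 ^ I.s : ℕ) : ℝ) + ((j % 2 ^ I.s : ℕ) : ℝ) := by
      rw [hS2]; exact_mod_cast h.symm
    rw [h', add_mul, mul_comm S2, mul_assoc, hRS2]
  set Q : ℤ := N - qE - ((j / 2 ^ I.s : ℕ) : ℤ) with hQ
  -- the positive generator absorbing the laps
  set u₀ : K := algebraMap (𝓞 K) K ε with hu₀
  have hu₀pos : 0 < σ₁ u₀ := by rw [hu₀]; linarith
  set α' : K := αE * u₀ ^ Q with hα'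
  have hα'pos : 0 < σ₁ α' := by rw [hα', map_mul, map_zpow₀]; exact mul_pos hαE (zpow_pos hu₀pos Q)
  have hlogα' : Real.log (σ₁ α') = Real.log (σ₁ αE) + Q * R := by
    rw [hα', map_mul, map_zpow₀, Real.log_mul hαE.ne' (zpow_pos hu₀pos Q).ne', Real.log_zpow, ← hreg]
  have hideal : FractionalIdeal.spanSingleton (𝓞 K)⁰ α' * Ag = FractionalIdeal.spanSingleton (𝓞 K)⁰ αE * Ag := by
    have hcoe : u₀ ^ Q = algebraMap (𝓞 K) K ((ε ^ Q : (𝓞 K)ˣ) : 𝓞 K) := by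
      rw [hu₀]; exact (NumberField.Units.coe_zpow ε Q).symm
    rw [hα', hcoe, ← FractionalIdeal.spanSingleton_mul_spanSingleton, mul_assoc, spanSingleton_unit_mul]
  -- the target coordinate in the coordinates of the class circle
  set uu : ℝ := (F.tstarc I cap v : ℝ) / 2 ^ I.prec - Real.log (σ₁ α') with huu
  have huu_eq : uu = (σE : ℝ) * (R / S2) + (j : ℝ) * (R / S2) + ((yE - σE) * (R / S2) + err) := by
    have e1 : (F.tstarc I cap v : ℝ) / 2 ^ I.prec = err + (((j % 2 ^ I.s : ℕ) : ℝ) * (R / S2) + (N : ℝ) * R + cδ * main) := by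
      rw [herrdef]; ring
    have e2 : cδ * main = yE * (R / S2) - qE * R + Real.log (σ₁ αE) := by linarith [hqE]
    have e3 : ((Q : ℤ) : ℝ) = (N : ℝ) - qE - ((j / 2 ^ I.s : ℕ) : ℝ) := by
      simp only [hQ, Int.cast_sub, Int.cast_natCast]
    rw [huu, hlogα', e1, e2, e3, hjdec]; ring
  have hwin1 : (σE : ℝ) * (R / S2) + (j : ℝ) * (R / S2) - ηd < uu := by
    rw [huu_eq]
    have h1 : 0 ≤ (yE - σE) * (R / S2) := mul_nonneg (by linarith [hσE.1]) hΔpos.le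
    have h2 : -(ηd / 2) ≤ err := (abs_le.mp herrb).1
    linarith
  have hwin2 : uu < (σE : ℝ) * (R / S2) + (j : ℝ) * (R / S2) + R / S2 + ηd := by
    rw [huu_eq]
    have h1 : (yE - σE) * (R / S2) < R / S2 := by
      have : (yE - σE) < 1 := by linarith [hσE.2]
      calc (yE - σE) * (R / S2) < 1 * (R / S2) := mul_lt_mul_of_pos_right this hΔpos
        _ = R / S2 := one_mul _
    have h2 : err ≤ ηd / 2 := (abs_le.mp herrb).2
    linarith
  -- ### the circle and the coordinate lemma
  have hmemc := fun i => voronoiChain_mem hdeg hσ₂ ε hε hx₀ i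
  have hposc : ∀ i, 0 < σ₁ (voronoiChain σ₁ σ₂ Ag x₀ i) := fun i => (hmemc i).2
  set G : ℤ → ℝ := fun i => Real.log (σ₁ (voronoiChain σ₁ σ₂ Ag x₀ i)) with hG
  have hGm : StrictMono G := fun i i' hii' =>
    Real.log_lt_log (hposc i) (voronoiChain_strictMono hdeg hσ₂ ε hε hx₀ hii')
  have hηd0 : 0 ≤ ηd := hηdpos.le
  obtain ⟨hfar, hcell⟩ := stub_semCoords G hGm n₀ hn₀ R hper idx hidx Lab hLabper I.npp I.s ηd ηd hηd0 hηd0 σE j uu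
    hwin1 hwin2 hgood
  -- ### the tolerance `η = R/2^(s+3)` absorbs the position error of the walk
  have hηle : (3 * Sd + 3 * (((6 * LD + 9 : ℕ) : ℝ) + 1) * (2 ^ (6 * LD + 9) * ((I.s₀ : ℝ) + 1)) + n + 2) / 2 ^ I.prec ≤
      ηd := by
    have hnum := num_eta (ℓe := I.ℓe) (s := I.s) (npp := I.npp) (LD := LD) (e := e) (sz := sz) (k := I.k)
      (prec := I.prec) (np := I.ps.length) (sab := Nat.size (I.a * I.b)) hR16 hsz hLD' hk hkprec hs
    rw [hηd]
    refine le_trans ?_ hnum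
    apply div_le_div_of_nonneg_right _ (by positivity)
    rw [hs₀]
    push_cast at hSdle hnmax ⊢
    linarith [hSdle, hnmax]
  -- ### matching the stopping cell
  have hβ' : β ∈ posRelMinima σ₁ σ₂ (FractionalIdeal.spanSingleton (𝓞 K)⁰ α' * Ag) := by rw [hideal]; exact hβ
  have hmn' : ∀ φ : K, Mem θ I.b (F.cfinq I cap v).1 φ ↔
      φ ∈ FractionalIdeal.spanSingleton (𝓞 K)⁰ β⁻¹ * (FractionalIdeal.spanSingleton (𝓞 K)⁰ α' * Ag) := by
    rw [hideal]; exact hmn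
  have hl' : |((F.redc I cap (F.cfinq I cap v).1).2 : ℝ) - 2 ^ I.prec *
      (Real.log (σ₁ (voronoiSucc σ₁ σ₂ (FractionalIdeal.spanSingleton (𝓞 K)⁰ α' * Ag) β)) - Real.log (σ₁ β))| ≤ 1 := by
    rw [hideal]; exact hl
  have hε0 : 0 ≤ 3 * Sd + 3 * (((6 * LD + 9 : ℕ) : ℝ) + 1) * (2 ^ (6 * LD + 9) * ((I.s₀ : ℝ) + 1)) + n := by positivity
  have hmatch := semTable_value_eq_cellB hdeg hσ₂ ε hε hab hab1 hθ hx₀ hLab hidx hα'pos hβ' hcn hmn' hnpp hε0 hpos hρ hlt hl'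
    hηle hfar
  -- ### conclusion
  have htab : F.classTableOpQ I cap v =
      ((F.cfinq I cap v).1, ((F.tstarc I cap v - (F.cfinq I cap v).2).toNat / 2 ^ (I.prec - I.npp) : ℕ)) := rfl
  obtain ⟨hm1, hm2, -⟩ := hmatch
  rw [htab, hm1, hm2]
  exact hcell

end Core

/-- **P5b helper `classTableSem_coreB`** (registered): one table value is the shift-cell value (`table_value_eq_shiftCell`, closed form). -/
theorem classTableSem_coreB : ∀ {K : Type} [Field K] [NumberField K] {θ : K} {σ₁ : K →+* ℝ} {σ₂ : K →+* ℂ} {F : WalkFns} {I : Inst} (hdeg : Module.finrank ℚ K = 3) (hσ₂ : ∃ z : K, starRingEnd ℂ (σ₂ z) ≠ σ₂ z) (ε : (𝓞 K)ˣ) (hε : 1 < σ₁ (algebraMap (𝓞 K) K ε)) (hreg : Real.log (σ₁ (algebraMap (𝓞 K) K ε)) = Units.regulator K) (hab : Squarefree (I.a * I.b)) (hab1 : I.a * I.b ≠ 1) (hθ : θ ^ 3 = ((I.a * I.b ^ 2 : ℕ) : K)) (hred : RedSem F I.a I.b K θ σ₁ σ₂) (hprod : ProdSpec I.a I.b K θ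 F.latProd) {cap : ℕ} (hcap : (243 * I.a ^ 2 * I.b ^ 2) ^ 2 ≤ cap) (hord : Canon I.ord) (hordm : ∀ φ : K, Mem θ I.b I.ord φ ↔ IsIntegral ℤ φ) (h6 : ∀ A : FractionalIdeal (𝓞 K)⁰ K, A ≠ 0 → ∀ x₀ ∈ posRelMinima σ₁ σ₂ A, ∀ i : ℤ, 2 * σ₁ (voronoiChain σ₁ σ₂ A x₀ i) ≤ σ₁ (voronoiChain σ₁ σ₂ A x₀ (i + 6))) (hR6 : Real.log 2 / 6 ≤ Units.regulator K) (hs₀ : I.s₀ = 18 * (10 * Nat.size (I.a * I.b) + 48)) (hTdbl : 6 * Nat.size (27 * I.a ^ 2 * I.b ^ 2) + 16 ≤ I.Tdbl) (hBb : 32 * (10 * Nat.size (I.a * I.b) + 48) ^ 2 ≤ I.Bb) (hmargin : I.margin = 0) (hr : |(I.r : ℝ) - 2 ^ I.k * Units.regulator K| ≤ 1) {e sz : ℕ} (hsz : I.ps.length < 2 ^ sz) (hk : I.ℓe + I.s + I.npp + 60 + 6 * Nat.size (27 * I.a ^ 2 * I.b ^ 2) + e + 2 * sz ≤ I.k) (hkprec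 : I.k + I.s + I.npp + 64 ≤ I.prec) (hs : I.npp + 6 * Nat.size (27 * I.a ^ 2 * I.b ^ 2) + 50 + e ≤ I.s) {𝔤 : ℕ → Ideal (𝓞 K)} {γ : ℕ → K} (hslot : ∀ v, ∀ t < I.T, 𝔤 t ≠ ⊥ ∧ Canon (F.gT I v t) ∧ (∀ φ : K, Mem θ I.b (F.gT I v t) φ ↔ φ ∈ (𝔤 t : FractionalIdeal (𝓞 K)⁰ K)) ∧ γ t ∈ (𝔤 t : FractionalIdeal (𝓞 K)⁰ K) ∧ 0 < σ₁ (γ t) ∧ ‖σ₂ (γ t)‖ < 1 ∧ (∀ φ : K, φ ∈ (𝔤 t : FractionalIdeal (𝓞 K)⁰ K) → 0 < σ₁ φ → ‖σ₂ φ‖ < 1 → σ₁ (γ t) ≤ σ₁ φ)) {E j : ℕ} (hE : E < I.W) (hj : j < 2 ^ I.ℓy) {Ag : FractionalIdeal (𝓞 K)⁰ K} {αE : K} (hαE : 0 < σ₁ αE) (hAE : ∏ t ∈ Finset.range I.T, ((𝔤 t : Ideal (𝓞 K)) : FractionalIdeal (𝓞 K)⁰ K) ^ (E / (2 ^ I.ℓe)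 ^ t % 2 ^ I.ℓe) = FractionalIdeal.spanSingleton (𝓞 K)⁰ αE * Ag) {x₀ : K} (hx₀ : x₀ ∈ posRelMinima σ₁ σ₂ Ag) {n₀ : ℕ} (hn₀ : 0 < n₀) (hper : ∀ i, Real.log (σ₁ (voronoiChain σ₁ σ₂ Ag x₀ (i + n₀))) = Real.log (σ₁ (voronoiChain σ₁ σ₂ Ag x₀ i)) + Units.regulator K) {idx : ℝ → ℤ} (hidx : ∀ x, Real.log (σ₁ (voronoiChain σ₁ σ₂ Ag x₀ (idx x))) ≤ x ∧ x < Real.log (σ₁ (voronoiChain σ₁ σ₂ Ag x₀ (idx x + 1)))) {Lab : ℤ → ℕ × List ℤ} (hLab : ∀ i, Canon (Lab i) ∧ ∀ φ : K, Mem θ I.b (Lab i) φ ↔ φ ∈ FractionalIdeal.spanSingleton (𝓞 K)⁰ (voronoiChain σ₁ σ₂ Ag x₀ i)⁻¹ * Ag) (hLabper : ∀ i j, Lab i = Lab j ↔ (n₀ : ℤ) ∣ i - j) {yE : ℝ} {σE : ℕ} (hσE : (σE : ℝ) ≤ yE ∧ yE < σE + 1) (hyE : ∃ q : ℤ, yE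 * (Units.regulator K / ((2 ^ I.s : ℕ) : ℝ)) = (-Real.log (σ₁ αE) + ((I.r : ℝ) / 2 ^ I.k - Units.regulator K) / ((I.r : ℝ) / 2 ^ I.k) * ∑ t ∈ Finset.range I.T, ((E / (2 ^ I.ℓe) ^ t % 2 ^ I.ℓe : ℕ) : ℝ) * Real.log (σ₁ (γ t))) + q * Units.regulator K) (hgood : ∀ (k : ℤ) (m : ℕ), (m : ℝ) / (2 : ℝ) ^ I.npp < Real.log (σ₁ (voronoiChain σ₁ σ₂ Ag x₀ (k + 1))) - Real.log (σ₁ (voronoiChain σ₁ σ₂ Ag x₀ k)) → ¬ ((σE : ℝ) * (Units.regulator K / ((2 ^ I.s : ℕ) : ℝ)) + (j : ℝ) * (Units.regulator K / ((2 ^ I.s : ℕ) : ℝ)) - (Units.regulator K / 2 ^ (I.s + 3) + Units.regulator K / 2 ^ (I.s + 3)) ≤ Real.log (σ₁ (voronoiChain σ₁ σ₂ Ag x₀ k)) + m / (2 : ℝ) ^ I.npp ∧ Real.log (σ₁ (voronoiChain σ₁ σ₂ Ag x₀ k)) + m / (2 : ℝ) ^ I.npp ≤ (σE : ℝ) * (Units.regulator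 K / ((2 ^ I.s : ℕ) : ℝ)) + (j : ℝ) * (Units.regulator K / ((2 ^ I.s : ℕ) : ℝ)) + Units.regulator K / ((2 ^ I.s : ℕ) : ℝ) + (Units.regulator K / 2 ^ (I.s + 3) + Units.regulator K / 2 ^ (I.s + 3)))), F.classTableOpQ I cap (E + I.W * j) = (Lab (idx ((((σE + j) % 2 ^ I.s : ℕ) : ℝ) * (Units.regulator K / ((2 ^ I.s : ℕ) : ℝ)))), ⌊(((((σE + j) % 2 ^ I.s : ℕ) : ℝ) * (Units.regulator K / ((2 ^ I.s : ℕ) : ℝ))) - Real.log (σ₁ (voronoiChain σ₁ σ₂ Ag x₀ (idx ((((σE + j) % 2 ^ I.s : ℕ) : ℝ) * (Units.regulator K / ((2 ^ I.s : ℕ) : ℝ))))))) * (2 : ℝ) ^ I.npp⌋₊) :=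
  table_value_eq_shiftCell

end Summit.QuantumAdvantage.QuantumAdvantage.Theorems.LinnikCubicClassGroups
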